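import Summits.NavierStokesRegularity.NavierStokesRegularity.Theorems.AdaptedFrequencyAdaptedKernelExistsKernelLimitPairing
import Summits.NavierStokesRegularity.NavierStokesRegularity.Theorems.AdaptedFrequencyAdaptedKernelExistsKernelLimitSlices
import Mathlib.MeasureTheory.Integral.Prod
import Mathlib.MeasureTheory.Integral.IntervalIntegral.IntegrationByParts

/-!
# Crux `AdaptedKernelExists` (stmt-NavierStokesRegularity-2956), line `nash-entropy-last-block`:
  STUB `stub_kernelLimit`, part 4b — an adapted kernel is a very weak solution

Helper file (lands `--supports stmt-NavierStokesRegularity-2956`) on the proof path of the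
registered stub `stub_kernelLimit`.  The limit kernel is identified through the VERY WEAK FORM
of the backward drift–heat equation (the currency of the gen-4 skeleton of the line):
for test functions `φ : ℝ × E → ℝ` (`C^∞`, compactly supported in the open slab
`Ioo tₘ T ×ˢ univ`),
`∫ p, w p * (deriv (fun s => φ (s, p.2)) p.1 + fderiv ℝ (fun y => φ (p.1, y)) p.2 (b p.1 p.2)
  − ν * Δ (fun y => φ (p.1, y)) p.2) = 0`.
This file proves that a CLASSICAL adapted backward kernel `G` of `∂ₜ + b·∇ − νΔ` on `Ico tₘ T`
with a jointly smooth divergence-free drift satisfies it with `w = uncurry G`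
(`kernelLimit_veryWeak_of_adapted`): Fubini, integration by parts in time on a compact interval
`[a₁, b₁] ⊂ (tₘ, T)` carrying the `t`-support of `φ`, the transport identity (`div b = 0`,
`kernelLimit_integral_mul_fderiv_apply`) and Green's second identity
(`Literature.Analysis.PDE.Rellich.integral_mul_laplacian_eq`) in space, and the adjoint equation.
-/

noncomputable section

open MeasureTheory Set Filter Topology Metric Function
open scoped Laplacian ContDiff
open Literature.Analysis.FluidPDE

namespace Summit.NavierStokesRegularity.NavierStokesRegularity.Theorems.AdaptedKernelExists.NashEntropyLastBlock

section General

variable {E : Type*} [NormedAddCommGroup E] [InnerProductSpace ℝ E] [FiniteDimensional ℝ E]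
  [MeasurableSpace E] [BorelSpace E]

/-! ### The very weak identity for a classical adapted kernel -/

/-- **A classical adapted kernel is a very weak solution.**  For an adapted backward kernel `G`
of `∂ₜ + b·∇ − νΔ` on `Ico tₘ T` with a jointly smooth divergence-free drift and every test
function `φ` (`C^∞`, compact support inside the open slab `Ioo tₘ T ×ˢ univ`):
`∫ p, G p.1 p.2 (∂ₜφ + Dₓφ[b] − νΔₓφ)(p) = 0`.
Proof: the integrand is continuous with compact support; by Fubini it is
`∫ₜ (∫ₓ G ∂ₜφ + ∫ₓ G Dφ[b] − ν ∫ₓ G Δφ)`; integration by parts in `t` on a compact interval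
carrying the `t`-support of `φ` (Fubini both ways) turns the first term into `−∫ₜ∫ₓ ∂ₜG φ`, the
transport identity (`div b = 0`) and Green's identity turn the other two into `−∫ₓ φ DG[b]` and
`∫ₓ ΔG φ`, and the adjoint equation `∂ₜG + DG[b] + νΔG = 0` finishes. -/
theorem kernelLimit_veryWeak_of_adapted {ν tₘ T : ℝ} {b : ℝ → E → E} {x₀ : E} {G : ℝ → E → ℝ}
    (hb : IsSmoothSpaceTimeOn (Ico tₘ T) b) (hdiv : ∀ t ∈ Ico tₘ T, VectorCalculus.IsDivFree (b t))
    (hG : IsAdaptedBackwardKernel ν b (Ico tₘ T) T x₀ G) {φ : ℝ × E → ℝ} (hφ : ContDiff ℝ ∞ φ)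
    (hφc : HasCompactSupport φ) (hφs : tsupport φ ⊆ Ioo tₘ T ×ˢ univ) :
    ∫ p : ℝ × E, G p.1 p.2 * (deriv (fun s => φ (s, p.2)) p.1 +
      fderiv ℝ (fun y => φ (p.1, y)) p.2 (b p.1 p.2) - ν * (Δ (fun y => φ (p.1, y))) p.2) = 0 := by
  -- notation and basic regularity
  set O : Set (ℝ × E) := Ioo tₘ T ×ˢ univ with hO_def
  have hO : IsOpen O := isOpen_Ioo.prod isOpen_univ
  have hIco : Ioo tₘ T ⊆ Ico tₘ T := Ioo_subset_Ico_self
  have hφ1 : ContDiff ℝ 1 φ := hφ.of_le (by norm_cast)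
  have hφ2 : ContDiff ℝ 2 φ := hφ.of_le (by norm_cast)
  have hG2 : ContDiffOn ℝ 2 (uncurry G) O := hG.contDiffOn.mono (prod_mono hIco Subset.rfl)
  have hGc : ContinuousOn (fun p : ℝ × E => G p.1 p.2) O := hG2.continuousOn
  have hbc : ContinuousOn (fun p : ℝ × E => b p.1 p.2) O := hb.continuousOn.mono (prod_mono hIco Subset.rfl)
  have hD : ∀ p ∈ O, HasFDerivAt (uncurry G) (fderiv ℝ (uncurry G) p) p := fun p hp =>
    ((hG2.differentiableOn (by norm_num)).differentiableAt (hO.mem_nhds hp)).hasFDerivAt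
  have hDtc : ContinuousOn (fun p : ℝ × E => fderiv ℝ (uncurry G) p (1, 0)) O :=
    (hG2.continuousOn_fderiv_of_isOpen hO (by norm_num)).clm_apply continuousOn_const
  -- the slice derivatives of `φ`
  set φt : ℝ × E → ℝ := fun p => deriv (fun s => φ (s, p.2)) p.1 with hφt
  set φb : ℝ × E → ℝ := fun p => fderiv ℝ (fun y => φ (p.1, y)) p.2 (b p.1 p.2) with hφb
  set φΔ : ℝ × E → ℝ := fun p => (Δ (fun y => φ (p.1, y))) p.2 with hφΔ
  have hφt_c : Continuous φt := kernelLimit_continuous_deriv_slice hφ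
  have hφΔ_c : Continuous φΔ := kernelLimit_continuous_laplacian_slice hφ
  have hφb_c : Continuous φb := by
    refine kernelLimit_continuous_of_tsupport_subset hO ?_ ?_
    · exact (kernelLimit_continuous_fderiv_slice hφ).continuousOn.clm_apply hbc
    · refine (closure_minimal (fun p hp => ?_) (isClosed_tsupport φ)).trans hφs
      by_contra h
      exact hp (kernelLimit_sliceDerivs_eq_zero h (b p.1 p.2)).2.1
  have hzero : ∀ p ∉ tsupport φ, φt p = 0 ∧ φb p = 0 ∧ φΔ p = 0 := fun p hp =>
    kernelLimit_sliceDerivs_eq_zero hp (b p.1 p.2)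
  -- the trivial case `φ = 0`
  by_cases hne' : ¬ (tsupport φ).Nonempty
  · have h0 : ∀ p, p ∉ tsupport φ := fun p hp => hne' ⟨p, hp⟩
    have : (fun p : ℝ × E => G p.1 p.2 * (deriv (fun s => φ (s, p.2)) p.1 +
        fderiv ℝ (fun y => φ (p.1, y)) p.2 (b p.1 p.2) - ν * (Δ (fun y => φ (p.1, y))) p.2)) =
        fun _ => 0 := by
      funext p
      have h := hzero p (h0 p)
      simp only [hφt, hφb, hφΔ] at h
      rw [h.1, h.2.1, h.2.2]; ring
    rw [this, integral_zero]
  push Not at hne'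
  -- products with a factor continuous on `O` and the test-function factors are continuous
  -- with compact support
  have hprod : ∀ {g h : ℝ × E → ℝ}, ContinuousOn g O → Continuous h →
      (∀ p ∉ tsupport φ, h p = 0) → Continuous (fun p => g p * h p) ∧
        HasCompactSupport (fun p => g p * h p) := by
    intro g h hg hh hh0
    have hsupp : tsupport (fun p => g p * h p) ⊆ tsupport φ := by
      refine closure_minimal (fun p hp => ?_) (isClosed_tsupport φ)
      by_contra h'
      exact hp (by simp [hh0 p h'])
    refine ⟨kernelLimit_continuous_of_tsupport_subset hO (hg.mul hh.continuousOn)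
      (hsupp.trans hφs), hφc.of_isClosed_subset (isClosed_tsupport _) hsupp⟩
  have hφ0 : ∀ p ∉ tsupport φ, φ p = 0 := fun p hp => image_eq_zero_of_notMem_tsupport hp
  obtain ⟨cF, sF⟩ := hprod hGc ((hφt_c.add hφb_c).sub ((continuous_const (y := ν)).mul hφΔ_c))
    (fun p hp => by simp [(hzero p hp).1, (hzero p hp).2.1, (hzero p hp).2.2])
  obtain ⟨cA, sA⟩ := hprod hGc hφt_c (fun p hp => (hzero p hp).1)
  obtain ⟨cA', sA'⟩ := hprod hDtc hφ.continuous hφ0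
  obtain ⟨cB, sB⟩ := hprod hGc hφb_c (fun p hp => (hzero p hp).2.1)
  obtain ⟨cC, sC⟩ := hprod hGc hφΔ_c (fun p hp => (hzero p hp).2.2)
  have iF := cF.integrable_of_hasCompactSupport (μ := volume) sF
  have iA := cA.integrable_of_hasCompactSupport (μ := volume) sA
  have iA' := cA'.integrable_of_hasCompactSupport (μ := volume) sA'
  have iB := cB.integrable_of_hasCompactSupport (μ := volume) sB
  have iC := cC.integrable_of_hasCompactSupport (μ := volume) sC
  -- rewrite the goal as an iterated integral
  have hvol : (volume : Measure (ℝ × E)) = (volume : Measure ℝ).prod (volume : Measure E) := rfl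
  change ∫ p : ℝ × E, G p.1 p.2 * ((φt p + φb p) - ν * φΔ p) = 0
  rw [hvol, integral_prod _ (hvol ▸ iF)]
  -- the inner integrals
  set A : ℝ → ℝ := fun t => ∫ x, G t x * φt (t, x) with hA
  set A' : ℝ → ℝ := fun t => ∫ x, fderiv ℝ (uncurry G) (t, x) (1, 0) * φ (t, x) with hA'
  set B : ℝ → ℝ := fun t => ∫ x, G t x * φb (t, x) with hB
  set C : ℝ → ℝ := fun t => ∫ x, G t x * φΔ (t, x) with hC
  have iAt : Integrable A := (hvol ▸ iA).integral_prod_left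
  have iA't : Integrable A' := (hvol ▸ iA').integral_prod_left
  have iBt : Integrable B := (hvol ▸ iB).integral_prod_left
  have iCt : Integrable C := (hvol ▸ iC).integral_prod_left
  -- slices are integrable (continuous with compact support in `x`)
  have hsl : ∀ {F : ℝ × E → ℝ}, Continuous F → HasCompactSupport F → ∀ t,
      Integrable fun x => F (t, x) := fun hF hFc t =>
    (hF.comp (continuous_const.prodMk continuous_id)).integrable_of_hasCompactSupport
      (kernelLimit_hasCompactSupport_slice hFc t)
  have hinner : ∀ t, ∫ x, G t x * ((φt (t, x) + φb (t, x)) - ν * φΔ (t, x)) =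
      A t + B t - ν * C t := by
    intro t
    have i1 : Integrable fun x => G t x * φt (t, x) := by simpa using hsl cA sA t
    have i2 : Integrable fun x => G t x * φb (t, x) := by simpa using hsl cB sB t
    have i3 : Integrable fun x => G t x * φΔ (t, x) := by simpa using hsl cC sC t
    have e : (fun x => G t x * ((φt (t, x) + φb (t, x)) - ν * φΔ (t, x))) =
        fun x => (G t x * φt (t, x) + G t x * φb (t, x)) - ν * (G t x * φΔ (t, x)) :=
      funext fun x => by ring
    simp only [hA, hB, hC]
    rw [e, integral_sub (f := fun x => G t x * φt (t, x) + G t x * φb (t, x))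
      (g := fun x => ν * (G t x * φΔ (t, x))) (i1.add i2) (i3.const_mul ν),
      integral_add i1 i2, integral_const_mul]
  simp_rw [hinner]
  -- a compact time interval carrying the `t`-support of `φ`
  obtain ⟨a₁, b₁, ha₁, hb₁, hab, hsupp⟩ : ∃ a₁ b₁ : ℝ, tₘ < a₁ ∧ b₁ < T ∧ a₁ < b₁ ∧
      ∀ p ∈ tsupport φ, p.1 ∈ Ioo a₁ b₁ := by
    set K : Set ℝ := Prod.fst '' tsupport φ with hK
    have hKc : IsCompact K := hφc.isCompact.image continuous_fst
    have hKne : K.Nonempty := hne'.image _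
    have hKI : K ⊆ Ioo tₘ T := by
      rintro _ ⟨p, hp, rfl⟩; exact (hφs hp).1
    have hlo := hKc.sInf_mem hKne
    have hhi := hKc.sSup_mem hKne
    refine ⟨(tₘ + sInf K) / 2, (sSup K + T) / 2, by linarith [(hKI hlo).1],
      by linarith [(hKI hhi).2], ?_, fun p hp => ?_⟩
    · have : sInf K ≤ sSup K := le_csSup hKc.bddAbove hlo
      linarith [(hKI hlo).1, (hKI hhi).2]
    · have hpK : p.1 ∈ K := ⟨p, hp, rfl⟩
      have h1 : sInf K ≤ p.1 := csInf_le hKc.bddBelow hpK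
      have h2 : p.1 ≤ sSup K := le_csSup hKc.bddAbove hpK
      exact ⟨by linarith [(hKI hlo).1], by linarith [(hKI hhi).2]⟩
  have hIab : Icc a₁ b₁ ⊆ Ioo tₘ T := fun t ht => ⟨ha₁.trans_le ht.1, ht.2.trans_lt hb₁⟩
  have hout : ∀ t, t ∉ Ioo a₁ b₁ → ∀ x, (t, x) ∉ tsupport φ := fun t ht x hp => ht (hsupp _ hp)
  have hnotO : ∀ t, t ∉ Ioo tₘ T → ∀ x, (t, x) ∉ tsupport φ := fun t ht x hp => ht (hφs hp).1
  -- (1) the time term: integration by parts in `t` at fixed `x`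
  have htime : ∀ x, ∫ t, G t x * φt (t, x) =
      -∫ t, fderiv ℝ (uncurry G) (t, x) (1, 0) * φ (t, x) := by
    intro x
    have hz1 : ∀ t, t ∉ Ioo a₁ b₁ → G t x * φt (t, x) = 0 := fun t ht => by
      rw [(hzero _ (hout t ht x)).1, mul_zero]
    have hz2 : ∀ t, t ∉ Ioo a₁ b₁ → fderiv ℝ (uncurry G) (t, x) (1, 0) * φ (t, x) = 0 :=
      fun t ht => by rw [hφ0 _ (hout t ht x), mul_zero]
    have hred : ∀ {f : ℝ → ℝ}, (∀ t, t ∉ Ioo a₁ b₁ → f t = 0) →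
        ∫ t, f t = ∫ t in a₁..b₁, f t := by
      intro f hf
      rw [intervalIntegral.integral_of_le hab.le, ← integral_Icc_eq_integral_Ioc,
        setIntegral_eq_integral_of_forall_compl_eq_zero]
      exact fun t ht => hf t fun h => ht (Ioo_subset_Icc_self h)
    rw [hred hz1, hred hz2]
    have hu : ∀ t ∈ uIcc a₁ b₁, HasDerivAt (fun s => G s x)
        (fderiv ℝ (uncurry G) (t, x) (1, 0)) t := by
      intro t ht
      rw [uIcc_of_le hab.le] at ht
      exact hasDerivAt_timeLine (hD (t, x) ⟨hIab ht, mem_univ _⟩)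
    have hv : ∀ t ∈ uIcc a₁ b₁, HasDerivAt (fun s => φ (s, x)) (φt (t, x)) t := by
      intro t _
      have hdiff : DifferentiableAt ℝ (fun s => φ (s, x)) t :=
        ((hφ1.differentiable one_ne_zero).comp (differentiable_id.prodMk (differentiable_const x))) t
      exact hdiff.hasDerivAt
    have hmaps : MapsTo (fun t : ℝ => (t, x)) (uIcc a₁ b₁) O := fun t ht => by
      rw [uIcc_of_le hab.le] at ht
      exact ⟨hIab ht, mem_univ _⟩
    have hu' : IntervalIntegrable (fun t => fderiv ℝ (uncurry G) (t, x) (1, 0)) volume a₁ b₁ :=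
      (hDtc.comp (continuous_id.prodMk continuous_const).continuousOn hmaps).intervalIntegrable
    have hv' : IntervalIntegrable (fun t => φt (t, x)) volume a₁ b₁ :=
      (hφt_c.comp (continuous_id.prodMk continuous_const)).intervalIntegrable _ _
    have key := intervalIntegral.integral_mul_deriv_eq_deriv_mul hu hv hu' hv'
    have hφa : φ (a₁, x) = 0 := hφ0 _ (hout a₁ (fun h => lt_irrefl _ h.1) x)
    have hφb' : φ (b₁, x) = 0 := hφ0 _ (hout b₁ (fun h => lt_irrefl _ h.2) x)
    rw [key, hφa, hφb']
    ring
  have hAA' : ∫ t, A t = -∫ t, A' t := by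
    have e1 : ∫ t, A t = ∫ x, ∫ t, G t x * φt (t, x) := by
      simp only [hA]
      exact integral_integral_swap (hvol ▸ iA)
    have e2 : ∫ t, A' t = ∫ x, ∫ t, fderiv ℝ (uncurry G) (t, x) (1, 0) * φ (t, x) := by
      simp only [hA']
      exact integral_integral_swap (hvol ▸ iA')
    rw [e1, e2, ← integral_neg]
    exact integral_congr_ae (Eventually.of_forall fun x => htime x)
  -- (2) the transport term at fixed `t`
  have hBB : ∀ t, B t = -∫ x, φ (t, x) * fderiv ℝ (G t) x (b t x) := by
    intro t
    by_cases ht : t ∈ Ioo tₘ T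
    · have htI := hIco ht
      have hGt : ContDiff ℝ 1 (G t) := (hG.contDiff_slice htI).of_le (by norm_cast)
      have hbt : ContDiff ℝ 1 (b t) := (hb.contDiff_slice htI).of_le (by norm_cast)
      have hψt : ContDiff ℝ 1 (fun y => φ (t, y)) :=
        hφ1.comp (contDiff_const.prodMk contDiff_id)
      have hψtc : HasCompactSupport (fun y => φ (t, y)) := kernelLimit_hasCompactSupport_slice hφc t
      have h := kernelLimit_integral_mul_fderiv_apply hGt hψt hψtc hbt (hdiv t htI)
      simp only [hB, hφb]
      linarith
    · simp only [hB]
      have h1 : (fun x => G t x * φb (t, x)) = fun _ => 0 :=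
        funext fun x => by rw [(hzero _ (hnotO t ht x)).2.1, mul_zero]
      have h2 : (fun x => φ (t, x) * fderiv ℝ (G t) x (b t x)) = fun _ => 0 :=
        funext fun x => by rw [hφ0 _ (hnotO t ht x), zero_mul]
      rw [h1, h2, integral_zero, neg_zero]
  -- (3) Green's identity at fixed `t`
  have hCC : ∀ t, C t = ∫ x, (Δ (G t)) x * φ (t, x) := by
    intro t
    by_cases ht : t ∈ Ioo tₘ T
    · have hGt : ContDiff ℝ 2 (G t) := hG.contDiff_slice (hIco ht)
      have hψt : ContDiff ℝ 2 (fun y => φ (t, y)) := hφ2.comp (contDiff_const.prodMk contDiff_id)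
      have hψtc : HasCompactSupport (fun y => φ (t, y)) := kernelLimit_hasCompactSupport_slice hφc t
      simp only [hC, hφΔ]
      exact Literature.Analysis.PDE.Rellich.integral_mul_laplacian_eq hGt hψt hψtc
    · simp only [hC]
      have h1 : (fun x => G t x * φΔ (t, x)) = fun _ => 0 :=
        funext fun x => by rw [(hzero _ (hnotO t ht x)).2.2, mul_zero]
      have h2 : (fun x => (Δ (G t)) x * φ (t, x)) = fun _ => 0 :=
        funext fun x => by rw [hφ0 _ (hnotO t ht x), mul_zero]
      rw [h1, h2]
  -- (4) assembly: `∫ₜ (A + B − νC) = ∫ₜ (−A′ + B − νC) = ∫ₜ ∫ₓ φ (−∂ₜG − DG[b] − νΔG) = 0`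
  have iBC : Integrable (fun t => B t - ν * C t) := iBt.sub (iCt.const_mul ν)
  rw [show (fun t => A t + B t - ν * C t) = fun t => A t + (B t - ν * C t) from
    funext fun t => by ring, integral_add iAt iBC, hAA', ← integral_neg,
    ← integral_add (f := fun a => -A' a) iA't.neg iBC]
  refine integral_eq_zero_of_ae (Eventually.of_forall fun t => ?_)
  show -A' t + (B t - ν * C t) = 0
  rw [hBB t, hCC t]
  simp only [hA']
  by_cases ht : t ∈ Ioo tₘ T
  · have htI := hIco ht
    -- the adjoint equation at the interior time `t`
    have hadj : ∀ x, fderiv ℝ (uncurry G) (t, x) (1, 0) =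
        -(fderiv ℝ (G t) x (b t x)) - ν * (Δ (G t)) x := by
      intro x
      have heq := hG.adjoint_eq t htI x
      rw [timeDerivWithin_eq_deriv_of_mem_nhds (Ico_mem_nhds ht.1 ht.2),
        (hasDerivAt_timeLine (hD (t, x) ⟨ht, mem_univ x⟩)).deriv] at heq
      linarith
    -- integrability of the slices
    have hGt : ContDiff ℝ 2 (G t) := hG.contDiff_slice htI
    have hbt : ContDiff ℝ 1 (b t) := (hb.contDiff_slice htI).of_le (by norm_cast)
    have hψtc : HasCompactSupport (fun y => φ (t, y)) := kernelLimit_hasCompactSupport_slice hφc t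
    have hφtc' : Continuous fun y => φ (t, y) := hφ.continuous.comp (continuous_const.prodMk continuous_id)
    have i2 : Integrable fun x => φ (t, x) * fderiv ℝ (G t) x (b t x) :=
      (hφtc'.mul ((hGt.continuous_fderiv (by norm_num)).clm_apply hbt.continuous))
        |>.integrable_of_hasCompactSupport hψtc.mul_right
    have i3 : Integrable fun x => (Δ (G t)) x * φ (t, x) :=
      ((continuous_laplacian hGt).mul hφtc').integrable_of_hasCompactSupport hψtc.mul_left
    have e : ∀ x, fderiv ℝ (uncurry G) (t, x) (1, 0) * φ (t, x) =
        -(φ (t, x) * fderiv ℝ (G t) x (b t x)) - ν * ((Δ (G t)) x * φ (t, x)) := by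
      intro x; rw [hadj x]; ring
    have i1 : Integrable fun x => fderiv ℝ (uncurry G) (t, x) (1, 0) * φ (t, x) := by
      have := (i2.neg).sub (i3.const_mul ν)
      refine this.congr (Eventually.of_forall fun x => ?_)
      simp only [Pi.neg_apply, Pi.sub_apply]
      rw [e x]
    have hsum : (∫ x, fderiv ℝ (uncurry G) (t, x) (1, 0) * φ (t, x)) =
        -(∫ x, φ (t, x) * fderiv ℝ (G t) x (b t x)) - ν * ∫ x, (Δ (G t)) x * φ (t, x) := by
      have step1 : (∫ x, fderiv ℝ (uncurry G) (t, x) (1, 0) * φ (t, x)) =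
          ∫ x, (-(φ (t, x) * fderiv ℝ (G t) x (b t x)) - ν * ((Δ (G t)) x * φ (t, x))) :=
        integral_congr_ae (Eventually.of_forall fun x => e x)
      rw [step1, integral_sub, integral_neg, integral_const_mul]
      · exact i2.neg
      · exact i3.const_mul ν
    rw [hsum]
    ring
  · -- `t` off the slab: everything vanishes
    have h1 : (fun x => fderiv ℝ (uncurry G) (t, x) (1, 0) * φ (t, x)) = fun _ => 0 :=
      funext fun x => by rw [hφ0 _ (hnotO t ht x), mul_zero]
    have h2 : (fun x => φ (t, x) * fderiv ℝ (G t) x (b t x)) = fun _ => 0 :=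
      funext fun x => by rw [hφ0 _ (hnotO t ht x), zero_mul]
    have h3 : (fun x => (Δ (G t)) x * φ (t, x)) = fun _ => 0 :=
      funext fun x => by rw [hφ0 _ (hnotO t ht x), mul_zero]
    rw [h1, h2, h3, integral_zero]
    ring

end General

/-! ### Registered sub-goal (dimension three) -/

/-- **Registered sub-goal `stub_kernelLimit_veryWeakOfAdapted`** (the `ℝ³` form of
`kernelLimit_veryWeak_of_adapted`; part 4b of the proof of STUB `stub_kernelLimit`): a classical
adapted backward kernel with a jointly smooth divergence-free drift is a very weak solution. -/
theorem stub_kernelLimit_veryWeakOfAdapted :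
    ∀ (ν tₘ T : ℝ) (b : ℝ → EuclideanSpace ℝ (Fin 3) → EuclideanSpace ℝ (Fin 3)) (x₀ : EuclideanSpace ℝ (Fin 3)) (G : ℝ → EuclideanSpace ℝ (Fin 3) → ℝ) (φ : ℝ × EuclideanSpace ℝ (Fin 3) → ℝ), IsSmoothSpaceTimeOn (Ico tₘ T) b → (∀ t ∈ Ico tₘ T, VectorCalculus.IsDivFree (b t)) → IsAdaptedBackwardKernel ν b (Ico tₘ T) T x₀ G → ContDiff ℝ ∞ φ → HasCompactSupport φ → tsupport φ ⊆ Ioo tₘ T ×ˢ univ → ∫ p : ℝ × EuclideanSpace ℝ (Fin 3), G p.1 p.2 * (deriv (fun s => φ (s, p.2)) p.1 + fderiv ℝ (fun y => φ (p.1, y)) p.2 (b p.1 p.2) - ν * (Δ (fun y => φ (p.1, y))) p.2) = 0 :=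
  fun _ _ _ _ _ _ _ hb hdiv hG hφ hφc hφs => kernelLimit_veryWeak_of_adapted hb hdiv hG hφ hφc hφs

end Summit.NavierStokesRegularity.NavierStokesRegularity.Theorems.AdaptedKernelExists.NashEntropyLastBlock

end
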